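import Mathlib
import Summits.Ventures.HodgeRepro.OcticCMPointGaloisRingChars

/-!
# OcticCMPointGaloisRingConjDual — conjugate duality of `ω_{θ,β}` at conductor `2`

Blind re-derivation cell `pub-hodge-repro`, seat night-2 (gen 4, final cycle).  Target tree path
`lean/Summits/Ventures/HodgeRepro/OcticCMPointGaloisRingConjDual.lean`.  For the characters `ω_{θ,β}` of
`OcticCMPointGaloisRingChars.lean` and the conjugation `σ = Frobenius²` of `GR(4, 4)`:

  **`ω_{θ,β} ∘ σ = ω_{θ,β}⁻¹` iff `θ⁵ = 1` and `σ(β) ≡ β` mod `2GR`** (`omega_conjDual_iff`)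

— on `r^k`, `σ(r^k) = r^{4k}` so the tame condition is `θ^{4k} = θ^{−k}` for all `k`, i.e. `θ⁵ = 1`; on `1 + 2a`,
`σ(1 + 2a) = 1 + 2σ(a)` so the wild condition is `ψ̃_δ(2β σ(a)) = ψ̃_δ(−2βa)` for all `a`, i.e. (with
`ψ̃_δ ∘ σ = ψ̃_δ ∘ (−1 ·)` and the primitivity of `ψ̃_δ`) `σ(2β) = 2β`, i.e. `red2 (σ β) = red2 β` — the residue of `β`
is fixed by the Frobenius² of `𝔽₁₆`, i.e. lies in `𝔽₄` (the `3` non-zero residues `1, r⁵, r¹⁰` mod `2`;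
`numerics/gr44_units.py`).

**(E3) at conductor `2`** for four lines in one wild class (`E3_omega_of_N2`): with `β_j ≡ r^{k₀}` for all `j` and the tame
`N2` `θ₀θ₁ = θ₂θ₃`, `ε₀ε₁ = ε₂ε₃` follows from `π₀π₁ = π₂π₃` — the inert analogue of `OcticCMPointInertModel.E3_inert_of_N2`
at conductor `1`.

**What this is not.**  (E3) across different wild classes (the route's `N2` for the `β_j`) and the identification with the
octic face's characters are NOT here.
Nothing here says anything about the status of the Hodge conjecture for CM abelian varieties, which is NOT proved.
-/

set_option autoImplicit false

noncomputable section

namespace Summit.Ventures.HodgeRepro.PeriodCloser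

namespace GaloisRing

/-- `σ(r^k (1 + 2a)) = r^{4k} (1 + 2 σ(a))`. -/
theorem conjGR_teichmuller_mul (k : ℕ) (a : GR44) :
    conjGR (r ^ k * (1 + 2 * a)) = r ^ (4 * k) * (1 + 2 * conjGR a) := by
  rw [map_mul, map_pow, conjGR_r, map_add, map_one, map_mul, map_ofNat, ← pow_mul]

/-- `σ(r^k) = r^{(4k) mod 15}` as a Teichmüller power. -/
theorem conjGR_r_pow (k : Fin 15) : conjGR (r ^ (k : ℕ)) = r ^ ((4 * k : Fin 15) : ℕ) := by
  rw [map_pow, conjGR_r, ← pow_mul, Fin.val_mul, pow_eq_pow_mod _ r_pow_fifteen]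
  rfl

/-- **Conjugate duality of `ω_{θ,β}`**: `ω ∘ σ = ω⁻¹` iff `θ⁵ = 1` and `red2 (σ β) = red2 β`. -/
theorem omega_conjDual_iff (θ : ℂ) (hθ : θ ^ 15 = 1) (β : GR44) :
    (∀ x, omega θ hθ β (conjGR x) = (omega θ hθ β)⁻¹ x) ↔ θ ^ 5 = 1 ∧ red2 (conjGR β) = red2 β := by
  have hθ0 : θ ≠ 0 := by
    rintro rfl
    rw [zero_pow (by norm_num)] at hθ
    exact zero_ne_one hθ
  have h4 := four_eq_zero
  constructor
  · intro h
    constructor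
    · -- the tame condition at `u = r`: `θ⁴ = θ⁻¹`
      have h1 := h (r ^ ((1 : Fin 15) : ℕ) * (1 + 2 * 0))
      rw [conjGR_teichmuller_mul, map_zero, omega_inv, omega_apply,
        show r ^ (4 * ((1 : Fin 15) : ℕ)) * (1 + 2 * 0) = r ^ ((4 : Fin 15) : ℕ) * (1 + 2 * 0) by simp,
        omega_apply] at h1
      simp only [mul_zero, AddChar.map_zero_eq_one, mul_one] at h1
      -- `h1 : θ ^ 4 = θ⁻¹`
      have h1' : θ ^ 4 = θ⁻¹ := by simpa using h1
      have : θ ^ 5 = θ ^ 4 * θ := by ring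
      rw [this, h1', inv_mul_cancel₀ hθ0]
    · -- the wild condition at `u = 1 + 2a`: `ψ̃_δ(2β σ(a)) = ψ̃_δ(−2βa)` for all `a`
      have hw : ∀ a, psiTildeGR (2 * β * conjGR a) = psiTildeGR (2 * -β * a) := by
        intro a
        have h1 := h (r ^ ((0 : Fin 15) : ℕ) * (1 + 2 * a))
        rw [conjGR_teichmuller_mul, omega_inv, show 4 * ((0 : Fin 15) : ℕ) = ((0 : Fin 15) : ℕ) by simp,
          omega_apply, omega_apply, Fin.val_zero, pow_zero, one_mul, pow_zero, one_mul] at h1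
        exact h1
      -- `ψ̃_δ(2β σ a) = ψ̃_δ(σ(σ(2β) a)) = ψ̃_δ(−σ(2β) a)`, so `ψ̃_δ(−σ(2β) ·) = ψ̃_δ(−2β ·)` and `σ(2β) = 2β`
      have key : AddChar.mulShift psiTildeGR (-(conjGR (2 * β))) = AddChar.mulShift psiTildeGR (-(2 * β)) := by
        ext a
        rw [AddChar.mulShift_apply, AddChar.mulShift_apply]
        have e1 : -(conjGR (2 * β)) * a = conjGR (2 * β * conjGR a) * (-1) := by
          rw [map_mul conjGR (2 * β) (conjGR a), conjGR_conjGR]; ring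
        have e2 : -(2 * β) * a = 2 * -β * a := by ring
        rw [e1, e2, ← hw a, show conjGR (2 * β * conjGR a) * (-1) = -(conjGR (2 * β * conjGR a)) by ring,
          ← psiTildeGR_conjGR, conjGR_conjGR]
      have h2β : conjGR (2 * β) = 2 * β := by
        have := mulShift_psiTildeGR_injective key
        exact neg_injective this
      have h2 : 2 * (conjGR β - β) = 0 := by
        have := h2β
        rw [map_mul, map_ofNat] at this
        linear_combination this
      have h3 := red2_eq_zero_of_two_mul_eq_zero h2
      rw [sub_eq_add_neg, red2_add, red2_neg] at h3
      exact sub_eq_zero.1 (by rw [sub_eq_add_neg]; exact h3)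
  · rintro ⟨hθ5, hβ⟩ x
    -- `σ(2β) = 2β`
    have h2β : conjGR (2 * β) = 2 * β := by
      have h2 : 2 * (conjGR β - β) = 0 := by
        apply two_mul_eq_zero_of_red2_eq_zero
        rw [sub_eq_add_neg, red2_add, red2_neg, hβ, add_neg_cancel]
      rw [map_mul, map_ofNat]
      linear_combination h2
    by_cases hx : IsUnit x
    · obtain ⟨k, a, rfl⟩ := exists_teichmuller_mul_of_isUnit hx
      rw [conjGR_teichmuller_mul, omega_inv, show r ^ (4 * (k : ℕ)) = r ^ ((4 * k : Fin 15) : ℕ) by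
          rw [Fin.val_mul, pow_eq_pow_mod _ r_pow_fifteen]; rfl,
        omega_apply, omega_apply]
      -- the tame factor: `θ^{4k mod 15} = θ⁻¹^k` since `θ⁵ = 1`
      have htame : θ ^ ((4 * k : Fin 15) : ℕ) = θ⁻¹ ^ (k : ℕ) := by
        rw [Fin.val_mul, ← pow_eq_pow_mod _ hθ, inv_pow]
        apply eq_inv_of_mul_eq_one_left
        rw [← pow_add, show ((4 : Fin 15) : ℕ) * (k : ℕ) + (k : ℕ) = 5 * (k : ℕ) by
          rw [show ((4 : Fin 15) : ℕ) = 4 from rfl]; ring, pow_mul, hθ5, one_pow]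
      -- the wild factor: `ψ̃_δ(2β σ(a)) = ψ̃_δ(σ(2β a)) = ψ̃_δ(−2βa)`
      have hwild : psiTildeGR (2 * β * conjGR a) = psiTildeGR (2 * -β * a) := by
        rw [show 2 * β * conjGR a = conjGR (2 * β * a) by rw [map_mul, h2β], psiTildeGR_conjGR]
        congr 1
        ring
      rw [htame, hwild]
    · have hσx : ¬ IsUnit (conjGR x) := by
        intro hu
        apply hx
        have : x = conjGR (conjGR x) := (conjGR_conjGR x).symm
        rw [this]
        exact hu.map conjGR
      rw [MulChar.map_nonunit _ hσx, MulChar.map_nonunit _ hx]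

/-- **(E3) at `𝔮`, conductor `2`, for four lines in one wild class**: `⟨ω_{θ_j,β_j}, π_j⟩` with all `β_j ≡ r^{k₀}` mod
`2GR` and the tame `N2` `θ₀θ₁ = θ₂θ₃`; then `ε₀ε₁ = ε₂ε₃` follows from the `ϖ`-part `π₀π₁ = π₂π₃`
(`eps_omega`: `ε_j = π_j^n θ_j^{−k₀} ψ̃_δ(r^{k₀})`). -/
theorem E3_omega_of_N2 (θ : Fin 4 → ℂ) (hθ : ∀ j, θ j ^ 15 = 1) (β : Fin 4 → GR44) (k₀ : Fin 15)
    (hk : ∀ j, teich2 k₀ = red2 (β j)) (hθN2 : θ 0 * θ 1 = θ 2 * θ 3) (π : Fin 4 → ℂ)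
    (hπ : π 0 * π 1 = π 2 * π 3) (n : ℕ) :
    LocalChar.eps (1 / 16) n (⟨omega (θ 0) (hθ 0) (β 0), π 0⟩ : LocalChar GR44) psiTildeGR *
        LocalChar.eps (1 / 16) n (⟨omega (θ 1) (hθ 1) (β 1), π 1⟩ : LocalChar GR44) psiTildeGR =
      LocalChar.eps (1 / 16) n (⟨omega (θ 2) (hθ 2) (β 2), π 2⟩ : LocalChar GR44) psiTildeGR *
        LocalChar.eps (1 / 16) n (⟨omega (θ 3) (hθ 3) (β 3), π 3⟩ : LocalChar GR44) psiTildeGR := by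
  rw [eps_omega _ _ _ k₀ (hk 0), eps_omega _ _ _ k₀ (hk 1), eps_omega _ _ _ k₀ (hk 2), eps_omega _ _ _ k₀ (hk 3)]
  calc π 0 ^ n * (θ 0)⁻¹ ^ (k₀ : ℕ) * psiTildeGR (r ^ (k₀ : ℕ)) *
        (π 1 ^ n * (θ 1)⁻¹ ^ (k₀ : ℕ) * psiTildeGR (r ^ (k₀ : ℕ))) =
      (π 0 * π 1) ^ n * (θ 0 * θ 1)⁻¹ ^ (k₀ : ℕ) * psiTildeGR (r ^ (k₀ : ℕ)) ^ 2 := by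
        rw [mul_pow, mul_inv, mul_pow]; ring
    _ = (π 2 * π 3) ^ n * (θ 2 * θ 3)⁻¹ ^ (k₀ : ℕ) * psiTildeGR (r ^ (k₀ : ℕ)) ^ 2 := by rw [hπ, hθN2]
    _ = _ := by rw [mul_pow, mul_inv, mul_pow]; ring

end GaloisRing

end Summit.Ventures.HodgeRepro.PeriodCloser

end
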